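import Literature.AlgebraicGeometry.Surfaces.K3Surface
import Literature.AlgebraicGeometry.HodgeTheory.IsoTransport
import Literature.AlgebraicGeometry.HodgeTheory.GysinBaseChangeOfKunneth
import HarnessLib

/-!
# Route NikulinTwinTransport · crux `TwinSimilitudeAlgebraic` (stmt-HodgeConjecture-13674) —
# stub `stub_corrTranspose` of line `hyperkaehler-nikulin-anchors` (reshape r6, T2)

**The transpose of an algebraic correspondence between two projective K3 surfaces is an algebraic
correspondence acting through the other projection.**  For smooth projective `X`, `Y` over `ℂ`, the
braiding `σ = β_ Y X : Y ⊗ X ≅ X ⊗ Y` and a class `γ` on `(Y ⊗ X)(ℂ)`: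

* `σ₊ γ = t • (σ⁻¹)^* γ` for a scalar `t` (`complexGysin_braiding_hom_eq_smul`): `γ = σ^*((σ⁻¹)^* γ)`,
  so by the projection formula `σ₊ γ = σ₊(σ^*((σ⁻¹)^* γ) ∪ 1) = (σ⁻¹)^* γ ∪ σ₊ 1`, and
  `σ₊ 1 ∈ H⁰((X ⊗ Y)(ℂ); ℂ) = ℂ · 1` (`exists_eq_smul_one`);
* hence `σ₊ γ` is algebraic when `γ` is (`complexGysin_braiding_hom_mem_algebraicClasses`;
  isomorphisms pull algebraic classes back to algebraic classes, `mem_algebraicClasses_map_iff_of_iso`);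
* the action of `σ₊ γ` with the FIRST factor `X` receiving is the action of `γ` with the SECOND factor
  `X` receiving (`complexGysin_fst_cupProduct_snd_braiding`):
  `fst′₊(snd′^* u ∪ σ₊ γ) = fst′₊ σ₊(σ^* snd′^* u ∪ γ) = (σ ≫ fst′)₊(fst^* u ∪ γ) = snd₊(fst^* u ∪ γ)`
  (projection formula for `σ`, `σ ≫ snd′ = fst`, `σ ≫ fst′ = snd`, `complexGysin_comp`).

The registered stub `stub_corrTranspose` is the case of two K3 surfaces `S`, `Sg` and
`γ ∈ N²H⁴((Sg ⊗ S)(ℂ); ℂ)`: `γ′ := σ₊ γ ∈ N²H⁴((S ⊗ Sg)(ℂ); ℂ)` and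
`Corr[μ, S, Sg ; γ′, u] = snd₊(fst^* u ∪ γ)` for every `u ∈ H²(Sg(ℂ); ℂ)`.  It is the two-factor
version of `complexGysin_braiding_eq_smul` / `complexGysin_braiding_mem_algebraicClasses` /
`cupProduct_corrAction_eq` of `Theorems/EndoscopicMiddleDegreeAlgebraicOrEnvelopedStubCorrActionAdjoint`
(namespace `…Theorems.CoreSplittingLadder`).  Everything is proved; no named facts, no definitions.

## References

* [FultonYoungTableaux1997] W. Fulton, Young Tableaux, CUP 1997, Appendix B §B.1 (5)–(6).
* [Fulton1998] W. Fulton, Intersection Theory, 2nd ed., Springer 1998, §16.1 (transpose of a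
  correspondence).
* [HatcherAT2002] A. Hatcher, Algebraic Topology, CUP 2002, §3.3 Thm. 3.26.
-/

noncomputable section

set_option linter.dupNamespace false

open CategoryTheory MonoidalCategory CartesianMonoidalCategory
open scoped Manifold Matrix
open Literature.AlgebraicGeometry.Motives Literature.AlgebraicGeometry.HodgeTheory
open Literature.AlgebraicGeometry.Surfaces Literature.Geometry.Kaehler
open Literature.AlgebraicTopology.SingularHomology

namespace Summit.HodgeConjecture.HodgeConjecture.Theorems.NikulinTwinTransport

/-! ## Local notation — VERBATIM that of the registered skeleton
`Cruxes/TwinSimilitudeAlgebraic/Lines/hyperkaehler_nikulin_anchors.lean` -/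

/-- `Corr[μ, S, S', hS, hS' ; γ, y] = [γ]_* y = fst_*(snd^* y ∪ γ)`, the action of
`γ ∈ H⁴((S ⊗ S′)(ℂ); ℂ)` as a correspondence `H²(S′) → H²(S)` (the FIRST factor receives). Local notation
only, verbatim from the route's Theorems files; for `hS hS'` the K3 witnesses it is definitionally the
inline term of the route items. -/
local notation3 (prettyPrint := false) "Corr[" μ ", " S ", " S' ", " hS ", " hS' " ; " γ ", " y "]" =>
  complexGysin μ
    (IsSmoothProjective.tensor_holds (IsK3Surface.isSmoothProjective hS)
      (IsK3Surface.isSmoothProjective hS'))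
    (IsK3Surface.isSmoothProjective hS) (SemiCartesianMonoidalCategory.fst S S')
    (rfl : 2 * 1 + 2 * 2 + 2 * 2 = 2 * 1 + 2 * (2 + 2))
    (cupProduct (rfl : 2 * 1 + 2 * 2 = 2 * 1 + 2 * 2)
      (complexBetti.map (SemiCartesianMonoidalCategory.snd S S') (2 * 1) y) γ)

/-! ## The Gysin push-forward along the braiding of two factors -/

/-- **`σ₊ γ = t • (σ⁻¹)^* γ` for the braiding `σ = β_ Y X : Y ⊗ X ⟶ X ⊗ Y`** (`Y ⊗ X`, `X ⊗ Y` smooth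
projective of dimensions `d`, `d'`, `γ` of any degree `i`): `γ = σ^*((σ⁻¹)^* γ)`, so by the projection
formula `σ₊ γ = σ₊(σ^*((σ⁻¹)^* γ) ∪ 1) = (σ⁻¹)^* γ ∪ σ₊ 1`, and `σ₊ 1 ∈ H⁰((X ⊗ Y)(ℂ); ℂ) = ℂ · 1`
(`exists_eq_smul_one`, the variety being connected). Two-factor version of
`CoreSplittingLadder.complexGysin_braiding_eq_smul`. [cite: FultonYoungTableaux1997, Appendix B §B.1 (6)]
[cite: HatcherAT2002, §3.3 Thm. 3.26] -/
theorem complexGysin_braiding_hom_eq_smul (μ : OrientationFamily) (hμ : μ.HasPoincareDuality)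
    {d d' : ℕ} {X Y : SchemeOver ℂ} (hT : IsSmoothProjective d (Y ⊗ X))
    (hT' : IsSmoothProjective d' (X ⊗ Y)) {i : ℕ} (hi : i + 2 * d' = i + 2 * d)
    (γ : complexBetti (Y ⊗ X) i) :
    ∃ t : ℂ, complexGysin μ hT hT' (β_ Y X).hom hi γ = t • complexBetti.map (β_ Y X).inv i γ := by
  have h0 : 0 + 2 * d' = 0 + 2 * d := by omega
  obtain ⟨t, ht⟩ := exists_eq_smul_one μ hT'
    (complexGysin μ hT hT' (β_ Y X).hom h0 (singularCohomology.one ℂ (ComplexPoints (Y ⊗ X))))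
  refine ⟨t, ?_⟩
  have key := complexGysin_cup hμ hT hT' (β_ Y X).hom (Nat.add_zero i) hi h0 (Nat.add_zero i)
    (complexBetti.map (β_ Y X).inv i γ) (singularCohomology.one ℂ (ComplexPoints (Y ⊗ X)))
  rw [cupProduct_one, (β_ Y X).complexBetti_map_hom_map_inv, ht, map_smul, cupProduct_one] at key
  exact key

/-- **The braiding push-forward of an algebraic class is algebraic**: for `γ ∈ Nᵖ H²ᵖ((Y ⊗ X)(ℂ); ℂ)`,
`σ₊ γ = t • (σ⁻¹)^* γ` (`complexGysin_braiding_hom_eq_smul`) lies in `Nᵖ H²ᵖ((X ⊗ Y)(ℂ); ℂ)`, since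
isomorphisms pull algebraic classes back to algebraic classes (`mem_algebraicClasses_map_iff_of_iso`
for `σ.symm`) and `Nᵖ H²ᵖ` is a `ℂ`-subspace. Two-factor version of
`CoreSplittingLadder.complexGysin_braiding_mem_algebraicClasses`.
[cite: FultonYoungTableaux1997, Appendix B §B.1 (6)] [cite: Fulton1998, §16.1] -/
theorem complexGysin_braiding_hom_mem_algebraicClasses (μ : OrientationFamily)
    (hμ : μ.HasPoincareDuality) {d d' p : ℕ} {X Y : SchemeOver ℂ}
    (hT : IsSmoothProjective d (Y ⊗ X)) (hT' : IsSmoothProjective d' (X ⊗ Y))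
    (hi : 2 * p + 2 * d' = 2 * p + 2 * d) {γ : complexBetti (Y ⊗ X) (2 * p)}
    (hγ : γ ∈ algebraicClasses (Y ⊗ X) p) :
    complexGysin μ hT hT' (β_ Y X).hom hi γ ∈ algebraicClasses (X ⊗ Y) p := by
  obtain ⟨t, ht⟩ := complexGysin_braiding_hom_eq_smul μ hμ hT hT' hi γ
  rw [ht]
  exact Submodule.smul_mem _ t ((mem_algebraicClasses_map_iff_of_iso (β_ Y X).symm).2 hγ)

/-- **The correspondence `σ₊ γ` acts (first factor receiving) as `γ` acts through the second factor**:
for `X` smooth projective of dimension `l`, `Y ⊗ X` and `X ⊗ Y` smooth projective of dimensions `d`,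
`d'`, `γ ∈ H^q((Y ⊗ X)(ℂ); ℂ)` and `u ∈ Hᵖ(Y(ℂ); ℂ)`,
`fst′₊(snd′^* u ∪ σ₊ γ) = snd₊(fst^* u ∪ γ)` in `Hᵇ(X(ℂ); ℂ)` (`fst′, snd′` the projections of `X ⊗ Y`,
`fst, snd` those of `Y ⊗ X`, `σ = β_ Y X`). Projection formula for `σ` (`complexGysin_cup`) with
`σ^* ∘ snd′^* = (σ ≫ snd′)^* = fst^*` (`braiding_hom_snd`), then
`fst′₊ ∘ σ₊ = (σ ≫ fst′)₊ = snd₊` (`complexGysin_comp`, `braiding_hom_fst`). Two-factor version of steps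
e1–e3 of `CoreSplittingLadder.cupProduct_corrAction_eq`.
[cite: FultonYoungTableaux1997, Appendix B §B.1 (5)–(6)] [cite: Fulton1998, §16.1] -/
theorem complexGysin_fst_cupProduct_snd_braiding (μ : OrientationFamily) (hμ : μ.HasPoincareDuality)
    {l d d' : ℕ} {X Y : SchemeOver ℂ} (hX : IsSmoothProjective l X)
    (hT : IsSmoothProjective d (Y ⊗ X)) (hT' : IsSmoothProjective d' (X ⊗ Y)) {p q a b : ℕ}
    (hpq : p + q = a) (hq : q + 2 * d' = q + 2 * d) (hab' : a + 2 * l = b + 2 * d')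
    (hab : a + 2 * l = b + 2 * d) (γ : complexBetti (Y ⊗ X) q) (u : complexBetti Y p) :
    complexGysin μ hT' hX (fst X Y) hab'
        (cupProduct hpq (complexBetti.map (snd X Y) p u)
          (complexGysin μ hT hT' (β_ Y X).hom hq γ)) =
      complexGysin μ hT hX (snd Y X) hab (cupProduct hpq (complexBetti.map (fst Y X) p u) γ) := by
  have ha : a + 2 * d' = a + 2 * d := by omega
  -- `σ^* snd′^* = fst^*`
  have e1 : complexBetti.map (β_ Y X).hom p (complexBetti.map (snd X Y) p u) =
      complexBetti.map (fst Y X) p u := by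
    rw [← CategoryTheory.comp_apply, ← complexBetti.map_comp, braiding_hom_snd]
  -- `snd′^* u ∪ σ₊ γ = σ₊(fst^* u ∪ γ)` (projection formula for `σ`)
  have e2 : cupProduct hpq (complexBetti.map (snd X Y) p u)
        (complexGysin μ hT hT' (β_ Y X).hom hq γ) =
      complexGysin μ hT hT' (β_ Y X).hom ha
        (cupProduct hpq (complexBetti.map (fst Y X) p u) γ) := by
    rw [← complexGysin_cup hμ hT hT' (β_ Y X).hom hpq ha hq hpq (complexBetti.map (snd X Y) p u) γ,
      e1]
  -- `fst′₊ ∘ σ₊ = (σ ≫ fst′)₊ = snd₊`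
  have e3 : ∀ z, complexGysin μ hT' hX (fst X Y) hab' (complexGysin μ hT hT' (β_ Y X).hom ha z) =
      complexGysin μ hT hX (snd Y X) hab z := by
    intro z
    have hc := LinearMap.congr_fun (complexGysin_comp hμ hT hT' hX (β_ Y X).hom (fst X Y) ha hab') z
    rw [LinearMap.comp_apply] at hc
    rw [← hc]
    simp only [braiding_hom_fst]
  rw [e2, e3]

/-! ## The registered stub -/

/-- **Stub T2 of line `hyperkaehler-nikulin-anchors` — `CorrTranspose` (FORMAL: the transpose of an
algebraic correspondence).**  For projective K3 surfaces `S, Σ = Sg` and `γ ∈ N²H⁴((Σ ⊗ S)(ℂ))` there is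
`γ′ ∈ N²H⁴((S ⊗ Σ)(ℂ))` (namely `σ₊ γ`, `σ = β_ Σ S` the braiding; `σ₊ γ = t · (σ⁻¹)^* γ` is algebraic,
`complexGysin_braiding_hom_mem_algebraicClasses`) whose action `[γ′]_* u = fst′₊(snd′^* u ∪ γ′)` is
`snd₊(fst^* u ∪ γ)` (`complexGysin_fst_cupProduct_snd_braiding`): projection formula for `σ`
(`σ^* snd′^* = fst^*`), then `fst′₊ ∘ σ₊ = (σ ≫ fst′)₊ = snd₊` (`complexGysin_comp`, `braiding_hom_fst/snd`).
[cite: FultonYoungTableaux1997, Appendix B §B.1 (5)–(6)] [cite: Fulton1998, §16.1] -/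
theorem stub_corrTranspose :
    ∀ (μ : OrientationFamily), μ.HasPoincareDuality →
      ∀ (S Sg : SchemeOver ℂ) (hS : IsK3Surface S) (hSg : IsK3Surface Sg),
        ∀ γ ∈ algebraicClasses (MonoidalCategoryStruct.tensorObj Sg S) 2,
          ∃ γ' ∈ algebraicClasses (MonoidalCategoryStruct.tensorObj S Sg) 2,
            ∀ u : complexBetti Sg (2 * 1),
              Corr[μ, S, Sg, hS, hSg ; γ', u] =
                complexGysin μ
                  (IsSmoothProjective.tensor_holds (IsK3Surface.isSmoothProjective hSg)
                    (IsK3Surface.isSmoothProjective hS))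
                  (IsK3Surface.isSmoothProjective hS) (SemiCartesianMonoidalCategory.snd Sg S)
                  (rfl : 2 * 1 + 2 * 2 + 2 * 2 = 2 * 1 + 2 * (2 + 2))
                  (cupProduct (rfl : 2 * 1 + 2 * 2 = 2 * 1 + 2 * 2)
                    (complexBetti.map (SemiCartesianMonoidalCategory.fst Sg S) (2 * 1) u) γ) := by
  intro μ hμ S Sg hS hSg γ hγ
  exact ⟨_, complexGysin_braiding_hom_mem_algebraicClasses μ hμ
      (IsSmoothProjective.tensor_holds hSg.isSmoothProjective hS.isSmoothProjective)
      (IsSmoothProjective.tensor_holds hS.isSmoothProjective hSg.isSmoothProjective) rfl hγ,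
    fun u ↦ complexGysin_fst_cupProduct_snd_braiding μ hμ hS.isSmoothProjective
      (IsSmoothProjective.tensor_holds hSg.isSmoothProjective hS.isSmoothProjective)
      (IsSmoothProjective.tensor_holds hS.isSmoothProjective hSg.isSmoothProjective)
      rfl rfl rfl rfl γ u⟩

end Summit.HodgeConjecture.HodgeConjecture.Theorems.NikulinTwinTransport

end
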